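import Summits.Ventures.YMGap.Thresholds.TiltStability
import Literature.MathematicalPhysics.QuantumFieldTheory.Balaban1983to89.StrongCouplingDobrushinWindow
import HarnessLib

/-!
# Venture YMGap — ROBUST-BALL input: stability of an arbitrary one-link Kantorovich–Rubinstein modulus under a
# common bounded Lipschitz re-weighting (`K ↦ K · e^δ · (1 + 2√N · ℓ)`), kernel level, no curvature and no Dirichlet form

HONEST FRAMING: venture file of the cell `pub-ymgap` (QuantumFields programme), track Y2 ROBUST-BALL; strong-coupling LATTICE
bookkeeping at the level of ONE link.  Nothing about the continuum, no mass-gap claim, no statement about any perturbed lattice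
specification is made here: this file is the one-link INPUT such statements consume.

THE QUESTION (PLAN amendment 50 §Y2 (ii), "the crux — CHECK").  Every door of the cell (Dobrushin
`dlrMassGap_of_oneLinkKRModulus`, vertex star `star_window_of_oneLinkKRModulus`, slab / area law) is fed by ONE constant: the
one-link Kantorovich–Rubinstein modulus `OneLinkKRModulus N R K` of the tilted Haar family `ν_B(dg) ∝ exp(N Re tr(g B)) dg` on
`SU(N)` (`|ν_B(φ) − ν_{B'}(φ)| ≤ K · Lip φ · ‖B − B'‖_F` on `‖B‖_op ≤ R`).  A perturbation `V = Σ_X V_X` of the Wilson action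
changes the conditional law of one link, given the others, into `ν_{B,U}(dg) ∝ exp(N Re tr(g B) + U(g)) dg` where `U = U_ω`
collects the terms `V_X`, `X ∋` the link, at the current exterior `ω`.  Does the modulus survive, and with which factor?

THE ANSWER (this file, `su_oneLink_transfer_tilted` / `_add` / `su_oneLink_transfer`; the packaged schema
`OneLinkKRModulusTilt N R δ ℓ K` with its rows is the companion file `OneLinkTiltSchema`).  For EVERY modulus — Bakry–Émery's
`1/(1/2 − R)`, the `SU(2)` quarter modulus of `QuarterModulus*` (the `9/25` column), the eigen-modulus of `OneLinkEigenModulus`,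
a certified pair — and every measurable `U` with oscillation `≤ δ` (`U a − U b ≤ δ`) that is `ℓ`-Lipschitz (`ℓ ≥ 0`) for the
Frobenius distance: given `OneLinkKRModulus N R K`, the family `B ↦ ν_{B,U}` has modulus `K e^δ (1 + 2√N ℓ)` on the same ball,
uniformly in such `U`.  PROOF (pure measure theory, `TiltStability.abs_integral_tilted_sub_tilted_le`): centre the test function at the `ν_{B',U}`-mean, `φ_c := φ − ν_{B',U}(φ)`
(`|φ_c| ≤ Lip φ · diam`), and feed `ψ := φ_c · e^U / ν_B(e^U)` to the UNPERTURBED modulus: `ν_{B'}(ψ) = 0` exactly,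
`ν_B(ψ) = ν_{B,U}(φ) − ν_{B',U}(φ)`, and `Lip ψ ≤ e^δ · Lip φ · (1 + diam · ℓ)` because `0 ≤ e^U/ν_B(e^U) ≤ e^δ` and
`|e^{U a} − e^{U b}| / ν_B(e^U) ≤ e^δ ℓ ‖a − b‖_F`; `diam_F SU(N) ≤ 2√N` (`suFrobDist_le`).  No curvature, no Poincaré
inequality, no smoothness of `U` beyond Lipschitz.  THE `ℓ`-DEPENDENCE IS NECESSARY FOR THIS BLACK-BOX TRANSFER (module-level
remark, not formalised): for `μ = ½(δ_a + δ_b)`, `μ' = ½(δ_{a'} + δ_b)`, `d(a,a') = η`, and `U = 0` near `a`, `U = δ` near `a'`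
and at `b` (`Lip U = δ/η`), `W₁(μ, μ') = η/2` while `W₁(μ^U, μ'^U) ≥ (e^δ − 1)/(2(e^δ + 1)) · (d(a,b) − η)` — a statement that
knows only the modulus of the pair cannot survive an oscillation-bounded tilt without a Lipschitz load.  The EXPONENTIAL structure
of `B ↦ ν_B` offers a second, `ℓ`-free route through variance constants (Holley–Stroock: `K_U ≤ e^δ √(c v)` from a
Lipschitz-Poincaré constant `c` and a variance bound `v` on the ball — the engine-2 lineage's `OneLinkHolleyStroock`, not this
file); a robust door takes the minimum of the two.  The CROSS leg (below) needs the cross-Lipschitz load on either route.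

ALSO HERE.  `abs_integral_tilted_sub_tilted_le_of_osc` (GRÜSS'S INEQUALITY FOR TILTS, abstract: `|μ^U(φ) − μ^{U'}(φ)| ≤
osc φ · osc(U − U')/4`, from the tree's interpolation lemma with the trivial weight and Popoviciu's variance bound) and its
`SU(N)` form `su_abs_integral_tilt_sub_tilt_le`: the `U`-direction ("cross influence") bound
`|μ^{−h}(φ) − μ^{−h'}(φ)| ≤ √N · Lip φ · sup|h − h'|` for EVERY base probability measure — Poincaré-free (where a certified
Lipschitz-Poincaré constant `c` is available, `√c` replaces `√N`: the engine-2 lineage's `OneLinkHolleyStroock`, not this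
file).  `su_oneLink_transfer`: the transfer in the binder shape of the ROBUST-BALL design (U1).  This file is definition-free.

References (mechanism; nothing is cited as a fact): R. L. Dobrushin, Theory Probab. Appl. 15 (1970) 458–486, §5 (perturbed
specifications); H.-O. Georgii, *Gibbs Measures and Phase Transitions*, de Gruyter 1988, Ch. 8 (Dobrushin's comparison and
its stability); H. Shen, R. Zhu, X. Zhu, CMP 400 (2023) 805–851, the unnumbered remark after Rem. 1.3 (Dobrushin route).
-/

noncomputable section

open MeasureTheory ProbabilityTheory Real
open Literature.MathematicalPhysics.QuantumFieldTheory
open Literature.MathematicalPhysics.QuantumFieldTheory.Balaban1983to89.StrongCouplingDobrushinWindow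
open Summit.Ventures.YMGap.TiltStability

namespace Summit.Ventures.YMGap.OneLinkTiltStability

/-! ## §1b (abstract, continued) Grüss's inequality for tilts: the tilt direction costs `osc φ · osc(U − U') / 4` -/

section Gruss

variable {S : Type*} [MeasurableSpace S]

/-- **Grüss's inequality for tilts.**  For a probability measure `μ`, bounded measurable `U, U'` and a bounded measurable
`φ` with `osc φ ≤ Ω` (`|φ a − φ b| ≤ Ω`) and `osc (U − U') ≤ η`: `|μ^U(φ) − μ^{U'}(φ)| ≤ Ω · η / 4`.  Proof: the tree's
interpolation lemma `abs_integral_tilted_add_sub_le` along `μ^{U' + t(U − U')}` with the TRIVIAL weight `r ≡ 1` and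
`K = 4` — its variance hypothesis is Popoviciu's inequality `Var ψ ≤ (osc ψ)²/4` (`integral_sq_sub_mean_le_of_abs_sub_le` at
the mid-range centre `exists_centre_of_lipschitz`).  No Poincaré constant, valid at every tilt; the derivative form of
`|Cov_ν(φ, W)| ≤ osc φ · osc W / 4` (G. Grüss, Math. Z. 39 (1935) 215–226). [folklore] -/
theorem abs_integral_tilted_sub_tilted_le_of_osc {μ : Measure S} [IsProbabilityMeasure μ] {U U' φ : S → ℝ}
    {Ω η : ℝ} (hU : Measurable U) (hUb : ∃ C, ∀ s, |U s| ≤ C) (hU' : Measurable U')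
    (hU'b : ∃ C, ∀ s, |U' s| ≤ C) (hφ : Measurable φ) (hφb : ∃ C, ∀ s, |φ s| ≤ C)
    (hφΩ : ∀ a b, |φ a - φ b| ≤ Ω) (hW : ∀ a b, |(U a - U' a) - (U b - U' b)| ≤ η) :
    |∫ s, φ s ∂μ.tilted U - ∫ s, φ s ∂μ.tilted U'| ≤ Ω * η / 4 := by
  haveI : Nonempty S := nonempty_of_isProbabilityMeasure μ
  obtain ⟨CU, hCU⟩ := hUb
  obtain ⟨CU', hCU'⟩ := hU'b
  have hΩ : 0 ≤ Ω := by simpa using hφΩ (Classical.arbitrary S) (Classical.arbitrary S)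
  have hη : 0 ≤ η := by simpa using hW (Classical.arbitrary S) (Classical.arbitrary S)
  set w : S → ℝ := fun s => U s - U' s with hwdef
  have hwm : Measurable w := hU.sub hU'
  have hwB : ∀ s, |w s| ≤ CU + CU' := fun s =>
    (abs_sub _ _).trans (add_le_add (hCU s) (hCU' s))
  have hUw : μ.tilted U = μ.tilted (fun u => U' u + w u) := by
    congr 1; funext u; simp only [hwdef]; ring
  rw [hUw]
  refine abs_integral_tilted_add_sub_le (μ := μ) (r := fun _ _ => (1 : ℝ)) (K := 4) hU' ⟨CU', hCU'⟩ hwm hwB hφ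
    hφb (by norm_num) hΩ hη (fun a b => by simpa using hφΩ a b) (fun a b => by simpa [hwdef] using hW a b) ?_
  -- Popoviciu's inequality along the interpolation
  intro t _ ψ M hψm hψb hM hψ1
  have hbd : ∀ u, |U' u + t * w u| ≤ CU' + |t| * (CU + CU') := fun u =>
    (abs_add_le _ _).trans (add_le_add (hCU' u) (by rw [abs_mul]; exact mul_le_mul_of_nonneg_left (hwB u) (abs_nonneg t)))
  set ν : Measure S := μ.tilted (fun u => U' u + t * w u) with hν
  haveI : IsProbabilityMeasure ν :=
    isProbabilityMeasure_tilted (integrable_exp_of_abs_le (hU'.add (hwm.const_mul t)) hbd)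
  obtain ⟨b₀, hb₀⟩ := exists_centre_of_lipschitz (r := fun _ _ : S => (1 : ℝ)) (D := 1) (fun _ _ => le_rfl) hψb hM hψ1
  have hT : ∀ u, |ψ u - b₀| ≤ M / 2 := fun u => by simpa using hb₀ u
  calc ∫ u, (ψ u - ∫ u', ψ u' ∂ν) ^ 2 ∂ν ≤ (M / 2) ^ 2 := integral_sq_sub_mean_le_of_abs_sub_le hψm hψb hT
    _ = M ^ 2 / 4 := by ring

end Gruss

/-! ## §2 `SU(N)`: the perturbed one-link family `ν_{B,U} ∝ exp(N Re tr(g B) + U(g)) dg` and the transfer of the modulus -/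

section SUN

variable {N : ℕ}

/-- A function on `SU(N)` of oscillation `≤ δ` is bounded (by `|U 1| + δ`). [folklore] -/
theorem su_exists_abs_le_of_osc {U : Matrix.specialUnitaryGroup (Fin N) ℂ → ℝ} {δ : ℝ}
    (hUδ : ∀ a b, U a - U b ≤ δ) : ∃ C, ∀ g, |U g| ≤ C :=
  ⟨|U 1| + δ, fun g => by
    have h1 := hUδ g 1
    have h2 := hUδ 1 g
    rw [abs_le]
    constructor
    · linarith [neg_abs_le (U 1)]
    · linarith [le_abs_self (U 1)]⟩

/-- The linear one-link potential `g ↦ N Re tr(g B)` is measurable and bounded by `N √N ‖B‖_F`, hence `e^{N Re tr(g B)}` is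
Haar-integrable and the tilted Haar law `ν_B` is a probability measure. [folklore] -/
theorem su_linear_potential_measurable_bounded (B : Matrix (Fin N) (Fin N) ℂ) :
    Measurable (fun g : Matrix.specialUnitaryGroup (Fin N) ℂ => (N : ℝ) * ((g : Matrix (Fin N) (Fin N) ℂ) * B).trace.re) ∧
      ∀ g : Matrix.specialUnitaryGroup (Fin N) ℂ,
        |(N : ℝ) * ((g : Matrix (Fin N) (Fin N) ℂ) * B).trace.re| ≤ (N : ℝ) * (Real.sqrt N * frobNorm B) := by
  refine ⟨(continuous_const.mul (continuous_re_trace_su_mul B)).measurable, fun g => ?_⟩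
  rw [abs_mul, abs_of_nonneg (Nat.cast_nonneg N)]
  exact mul_le_mul_of_nonneg_left (abs_re_trace_su_mul_le g B) (Nat.cast_nonneg N)

/-- `ν_{B,U} = (ν_B)^U`: tilting Haar by `N Re tr(g B) + U` is tilting the one-link law `ν_B` by `U` (`tilted_tilted`).
[folklore] -/
theorem su_tilted_linear_add (B : Matrix (Fin N) (Fin N) ℂ) (U : Matrix.specialUnitaryGroup (Fin N) ℂ → ℝ) :
    (haarProbability (Matrix.specialUnitaryGroup (Fin N) ℂ)).tilted
        (fun g => (N : ℝ) * ((g : Matrix (Fin N) (Fin N) ℂ) * B).trace.re + U g) =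
      ((haarProbability (Matrix.specialUnitaryGroup (Fin N) ℂ)).tilted
        fun g => (N : ℝ) * ((g : Matrix (Fin N) (Fin N) ℂ) * B).trace.re).tilted U := by
  obtain ⟨hm, hb⟩ := su_linear_potential_measurable_bounded (N := N) B
  rw [tilted_tilted (integrable_exp_of_abs_le hm hb) U]
  rfl

/-- The one-link law `ν_B` is a probability measure. [folklore] -/
theorem su_isProbabilityMeasure_tilted_linear (B : Matrix (Fin N) (Fin N) ℂ) :
    IsProbabilityMeasure ((haarProbability (Matrix.specialUnitaryGroup (Fin N) ℂ)).tilted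
      fun g => (N : ℝ) * ((g : Matrix (Fin N) (Fin N) ℂ) * B).trace.re) := by
  obtain ⟨hm, hb⟩ := su_linear_potential_measurable_bounded (N := N) B
  exact isProbabilityMeasure_tilted (integrable_exp_of_abs_le hm hb)

/-- **THE TRANSFER (def-free form).  Every one-link Kantorovich–Rubinstein modulus survives a common bounded Lipschitz
re-weighting of the one-link laws, with the explicit factor `e^δ (1 + 2√N ℓ)`:** if `OneLinkKRModulus N R K`, `U` is measurable
with `U a − U b ≤ δ` (oscillation `≤ δ`) and `|U a − U b| ≤ ℓ ‖a − b‖_F` (`ℓ ≥ 0`), then on the ball `‖B‖_op, ‖B'‖_op ≤ R`, for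
every bounded measurable `L`-Lipschitz `φ`: `|(ν_B)^U(φ) − (ν_{B'})^U(φ)| ≤ K e^δ (1 + 2√N ℓ) · L · ‖B − B'‖_F`.  The abstract lemma
`TiltStability.abs_integral_tilted_sub_tilted_le` for the pair `(ν_B, ν_{B'})` (modulus `A = K ‖B − B'‖_F` by hypothesis) with
`r = suFrobDist`, `D = 2√N` (`suFrobDist_le`).  No curvature, no Poincaré inequality, no smoothness of `U`; for a black-box
modulus the `ℓ`-dependence cannot be removed (module docstring).  The packaged schema `OneLinkKRModulusTilt` and its rows live
in `OneLinkTiltSchema`. [folklore] -/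
theorem su_oneLink_transfer_tilted {R K δ ℓ : ℝ} (hK : OneLinkKRModulus N R K) (hℓ : 0 ≤ ℓ)
    (U : Matrix.specialUnitaryGroup (Fin N) ℂ → ℝ) (hUm : Measurable U) (hUδ : ∀ a b, U a - U b ≤ δ)
    (hUℓ : ∀ a b, |U a - U b| ≤ ℓ * suFrobDist a b)
    (B B' : Matrix (Fin N) (Fin N) ℂ) (hB : matrixOpNorm B ≤ R) (hB' : matrixOpNorm B' ≤ R)
    (φ : Matrix.specialUnitaryGroup (Fin N) ℂ → ℝ) (L : ℝ) (hφm : Measurable φ) (hφb : ∃ M, ∀ s, |φ s| ≤ M)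
    (hL : 0 ≤ L) (hφL : ∀ a b, |φ a - φ b| ≤ L * suFrobDist a b) :
    |∫ s, φ s ∂(((haarProbability (Matrix.specialUnitaryGroup (Fin N) ℂ)).tilted
          fun g => (N : ℝ) * ((g : Matrix (Fin N) (Fin N) ℂ) * B).trace.re).tilted U) -
        ∫ s, φ s ∂(((haarProbability (Matrix.specialUnitaryGroup (Fin N) ℂ)).tilted
          fun g => (N : ℝ) * ((g : Matrix (Fin N) (Fin N) ℂ) * B').trace.re).tilted U)| ≤
      K * exp δ * (1 + 2 * Real.sqrt N * ℓ) * L * frobNorm (B - B') := by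
  haveI := su_isProbabilityMeasure_tilted_linear (N := N) B
  haveI := su_isProbabilityMeasure_tilted_linear (N := N) B'
  have key := abs_integral_tilted_sub_tilted_le
    (μ := (haarProbability (Matrix.specialUnitaryGroup (Fin N) ℂ)).tilted
      fun g => (N : ℝ) * ((g : Matrix (Fin N) (Fin N) ℂ) * B).trace.re)
    (μ' := (haarProbability (Matrix.specialUnitaryGroup (Fin N) ℂ)).tilted
      fun g => (N : ℝ) * ((g : Matrix (Fin N) (Fin N) ℂ) * B').trace.re)
    (r := suFrobDist) (A := K * frobNorm (B - B')) (D := 2 * Real.sqrt N)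
    suFrobDist_nonneg suFrobDist_le (by positivity) hUm (su_exists_abs_le_of_osc hUδ) hUδ hℓ hUℓ hφm hφb hL hφL
    (fun ψ M hψm hψb hM hψL => (hK B B' hB hB' ψ M hψm hψb hM hψL).trans (le_of_eq (by ring)))
  refine key.trans (le_of_eq ?_)
  ring

/-- The same transfer with the potentials written out: `ν_{B,U} = Haar` tilted by `N Re tr(g B) + U(g)`. [folklore] -/
theorem su_oneLink_transfer_add {R K δ ℓ : ℝ} (hK : OneLinkKRModulus N R K) (hℓ : 0 ≤ ℓ)
    (U : Matrix.specialUnitaryGroup (Fin N) ℂ → ℝ) (hUm : Measurable U) (hUδ : ∀ a b, U a - U b ≤ δ)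
    (hUℓ : ∀ a b, |U a - U b| ≤ ℓ * suFrobDist a b)
    (B B' : Matrix (Fin N) (Fin N) ℂ) (hB : matrixOpNorm B ≤ R) (hB' : matrixOpNorm B' ≤ R)
    (φ : Matrix.specialUnitaryGroup (Fin N) ℂ → ℝ) (L : ℝ) (hφm : Measurable φ) (hφb : ∃ M, ∀ s, |φ s| ≤ M)
    (hL : 0 ≤ L) (hφL : ∀ a b, |φ a - φ b| ≤ L * suFrobDist a b) :
    |∫ s, φ s ∂((haarProbability (Matrix.specialUnitaryGroup (Fin N) ℂ)).tilted
          fun g => (N : ℝ) * ((g : Matrix (Fin N) (Fin N) ℂ) * B).trace.re + U g) -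
        ∫ s, φ s ∂((haarProbability (Matrix.specialUnitaryGroup (Fin N) ℂ)).tilted
          fun g => (N : ℝ) * ((g : Matrix (Fin N) (Fin N) ℂ) * B').trace.re + U g)| ≤
      K * exp δ * (1 + 2 * Real.sqrt N * ℓ) * L * frobNorm (B - B') := by
  rw [su_tilted_linear_add B U, su_tilted_linear_add B' U]
  exact su_oneLink_transfer_tilted hK hℓ U hUm hUδ hUℓ B B' hB hB' φ L hφm hφb hL hφL

/-- **U2, the CROSS leg in Grüss form** (shape = rb-theory's `RobustBall.CrossLegTarget N`, `SUN N` unfolded): two re-weightings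
`μ^{−h}, μ^{−h'}` of the same probability measure on `SU(N)` with `|h − h'| ≤ s` pointwise differ on a bounded measurable
`Lφ`-Lipschitz `φ` by at most `√N · Lφ · s` — `abs_integral_tilted_sub_tilted_le_of_osc` with `osc φ ≤ Lφ · 2√N`
(`suFrobDist_le`) and `osc(h' − h) ≤ 2s`: `(2√N Lφ)(2s)/4`.  Valid for EVERY base measure (no radius, no Poincaré constant);
where a Lipschitz-Poincaré constant `c_P e^{a}` of the re-weighted law is certified, `√(c_P e^{a})` replaces `√N` (engine-2's
`OneLinkHolleyStroock`).  In the perturbed lattice action this is the influence of a link `y` on a link `x` through the terms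
`W_X`, `X ∋ x, y`: `s = Σ_{X∋x,y} Lip_y W_X · ‖ω_y − η_y‖_F`. [folklore] -/
theorem su_abs_integral_tilt_sub_tilt_le (μ : Measure (Matrix.specialUnitaryGroup (Fin N) ℂ)) [IsProbabilityMeasure μ]
    (h h' : Matrix.specialUnitaryGroup (Fin N) ℂ → ℝ) (s : ℝ) (hh : Measurable h) (hh' : Measurable h')
    (hhb : ∃ M, ∀ g, |h g| ≤ M) (hh'b : ∃ M, ∀ g, |h' g| ≤ M) (hs : ∀ g, |h g - h' g| ≤ s)
    (φ : Matrix.specialUnitaryGroup (Fin N) ℂ → ℝ) (Lφ : ℝ) (hφ : Measurable φ) (hφb : ∃ M, ∀ g, |φ g| ≤ M)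
    (hL : 0 ≤ Lφ) (hφL : ∀ a b, |φ a - φ b| ≤ Lφ * suFrobDist a b) :
    |∫ g, φ g ∂(μ.tilted fun g => -h g) - ∫ g, φ g ∂(μ.tilted fun g => -h' g)| ≤ Real.sqrt N * Lφ * s := by
  obtain ⟨M, hM⟩ := hhb
  obtain ⟨M', hM'⟩ := hh'b
  have hΩ : ∀ a b, |φ a - φ b| ≤ Lφ * (2 * Real.sqrt N) := fun a b =>
    (hφL a b).trans (mul_le_mul_of_nonneg_left (suFrobDist_le a b) hL)
  have hη : ∀ a b : Matrix.specialUnitaryGroup (Fin N) ℂ, |(-h a - -h' a) - (-h b - -h' b)| ≤ 2 * s := fun a b => by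
    have ha := hs a
    have hb := hs b
    calc |(-h a - -h' a) - (-h b - -h' b)| = |(h b - h' b) - (h a - h' a)| := by ring_nf
      _ ≤ |h b - h' b| + |h a - h' a| := abs_sub _ _
      _ ≤ 2 * s := by linarith
  have key := abs_integral_tilted_sub_tilted_le_of_osc (μ := μ) hh.neg ⟨M, fun g => by simpa using hM g⟩ hh'.neg
    ⟨M', fun g => by simpa using hM' g⟩ hφ hφb hΩ hη
  calc _ ≤ Lφ * (2 * Real.sqrt N) * (2 * s) / 4 := key
    _ = Real.sqrt N * Lφ * s := by ring

/-- **U1, the RE-WEIGHTING leg in rb-theory's shape** (`RobustBall.OneLinkTransferTarget N R K δ ℓ` unfolded, with the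
nonnegativity `0 ≤ ℓ` of the Lipschitz load made explicit): a modulus `OneLinkKRModulus N R K` and a measurable `h` with
`h g − h g' ≤ δ`, `|h g − h g'| ≤ ℓ ‖g − g'‖_F` give, for the re-weighted one-link laws `(ν_B)^{−h}`, `(ν_{B'})^{−h}` on the ball
`‖B‖_op, ‖B'‖_op ≤ R`: `|(ν_B)^{−h}(φ) − (ν_{B'})^{−h}(φ)| ≤ K e^δ (1 + 2√N ℓ) · Lφ · ‖B − B'‖_F`
(`su_oneLink_transfer_tilted` at `U = −h`). [folklore] -/
theorem su_oneLink_transfer {R K δ ℓ : ℝ} (hℓ : 0 ≤ ℓ) (hK : OneLinkKRModulus N R K)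
    (B B' : Matrix (Fin N) (Fin N) ℂ) (hB : matrixOpNorm B ≤ R) (hB' : matrixOpNorm B' ≤ R)
    (h : Matrix.specialUnitaryGroup (Fin N) ℂ → ℝ) (hh : Measurable h) (hδ : ∀ g g', h g - h g' ≤ δ)
    (hhℓ : ∀ g g', |h g - h g'| ≤ ℓ * suFrobDist g g')
    (φ : Matrix.specialUnitaryGroup (Fin N) ℂ → ℝ) (Lφ : ℝ) (hφ : Measurable φ) (hφb : ∃ M, ∀ s, |φ s| ≤ M)
    (hL : 0 ≤ Lφ) (hφL : ∀ a b, |φ a - φ b| ≤ Lφ * suFrobDist a b) :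
    |∫ s, φ s ∂(((haarProbability (Matrix.specialUnitaryGroup (Fin N) ℂ)).tilted
          fun g => (N : ℝ) * ((g : Matrix (Fin N) (Fin N) ℂ) * B).trace.re).tilted fun g => -h g) -
        ∫ s, φ s ∂(((haarProbability (Matrix.specialUnitaryGroup (Fin N) ℂ)).tilted
          fun g => (N : ℝ) * ((g : Matrix (Fin N) (Fin N) ℂ) * B').trace.re).tilted fun g => -h g)| ≤
      K * exp δ * (1 + 2 * Real.sqrt N * ℓ) * Lφ * frobNorm (B - B') := by
  exact su_oneLink_transfer_tilted (δ := δ) hK hℓ (fun g => -h g) hh.neg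
    (fun a b => by have := hδ b a; linarith)
    (fun a b => by rw [show -h a - -h b = h b - h a by ring, abs_sub_comm]; exact hhℓ a b)
    B B' hB hB' φ Lφ hφ hφb hL hφL

/-- **Both legs at once (the entry of a robust Dobrushin matrix).**  For a modulus `OneLinkKRModulus N R K`, re-weightings `h`
(oscillation `≤ δ`, `ℓ`-Lipschitz, `ℓ ≥ 0`) and `h'` (bounded measurable) with `|h − h'| ≤ s` pointwise, and `B, B'` in the ball:
`|(ν_B)^{−h}(φ) − (ν_{B'})^{−h'}(φ)| ≤ (K e^δ (1 + 2√N ℓ) · ‖B − B'‖_F + √N · s) · Lip φ` — U1 between `(B, h)` and `(B', h)`, then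
U2 between `(B', h)` and `(B', h')`.  In the perturbed lattice action, with `ω, η` differing at the link `y` only:
`‖B_ω − B_η‖_F ≤ |β| n(x,y) ‖ω_y − η_y‖_F` (`frobNorm_stapleField_sub_le`) and `s ≤ Λ_{x,y} ‖ω_y − η_y‖_F`, so the influence
coefficient is `C(x,y) = K e^δ (1 + 2√N ℓ) |β| n(x,y) + √N Λ_{x,y}`. [folklore] -/
theorem su_oneLink_robust_influence {R K δ ℓ s : ℝ} (hℓ : 0 ≤ ℓ) (hK : OneLinkKRModulus N R K)
    (B B' : Matrix (Fin N) (Fin N) ℂ) (hB : matrixOpNorm B ≤ R) (hB' : matrixOpNorm B' ≤ R)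
    (h h' : Matrix.specialUnitaryGroup (Fin N) ℂ → ℝ) (hh : Measurable h) (hh' : Measurable h')
    (hh'b : ∃ M, ∀ g, |h' g| ≤ M) (hδ : ∀ g g', h g - h g' ≤ δ) (hhℓ : ∀ g g', |h g - h g'| ≤ ℓ * suFrobDist g g')
    (hs : ∀ g, |h g - h' g| ≤ s)
    (φ : Matrix.specialUnitaryGroup (Fin N) ℂ → ℝ) (Lφ : ℝ) (hφ : Measurable φ) (hφb : ∃ M, ∀ s, |φ s| ≤ M)
    (hL : 0 ≤ Lφ) (hφL : ∀ a b, |φ a - φ b| ≤ Lφ * suFrobDist a b) :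
    |∫ s, φ s ∂(((haarProbability (Matrix.specialUnitaryGroup (Fin N) ℂ)).tilted
          fun g => (N : ℝ) * ((g : Matrix (Fin N) (Fin N) ℂ) * B).trace.re).tilted fun g => -h g) -
        ∫ s, φ s ∂(((haarProbability (Matrix.specialUnitaryGroup (Fin N) ℂ)).tilted
          fun g => (N : ℝ) * ((g : Matrix (Fin N) (Fin N) ℂ) * B').trace.re).tilted fun g => -h' g)| ≤
      (K * exp δ * (1 + 2 * Real.sqrt N * ℓ) * frobNorm (B - B') + Real.sqrt N * s) * Lφ := by
  haveI := su_isProbabilityMeasure_tilted_linear (N := N) B'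
  have h1 := su_oneLink_transfer hℓ hK B B' hB hB' h hh hδ hhℓ φ Lφ hφ hφb hL hφL
  have h2 := su_abs_integral_tilt_sub_tilt_le
    ((haarProbability (Matrix.specialUnitaryGroup (Fin N) ℂ)).tilted
      fun g => (N : ℝ) * ((g : Matrix (Fin N) (Fin N) ℂ) * B').trace.re)
    h h' s hh hh' (su_exists_abs_le_of_osc hδ) hh'b hs φ Lφ hφ hφb hL hφL
  calc _ ≤ _ := abs_sub_le _ _ _
    _ ≤ K * exp δ * (1 + 2 * Real.sqrt N * ℓ) * Lφ * frobNorm (B - B') + Real.sqrt N * Lφ * s := add_le_add h1 h2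
    _ = (K * exp δ * (1 + 2 * Real.sqrt N * ℓ) * frobNorm (B - B') + Real.sqrt N * s) * Lφ := by ring

end SUN

end Summit.Ventures.YMGap.OneLinkTiltStability
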